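import Summits.CriticalPhenomena.SAWScalingLimit.Theorems.SAWTensorRGConformalAvoidanceOfAvoidanceLimit
import Summits.CriticalPhenomena.SAWScalingLimit.Theorems.SAWTensorRGConformalAvoidanceStructure
import Summits.CriticalPhenomena.SAWScalingLimit.Theorems.SAWChargeContinuationSAWAvoidanceLawOfScalingLimit
import HarnessLib

/-!
# Crux `ConformalAvoidance` (stmt-CriticalPhenomena-7605, route `SAWTensorRG`) is summit-implied, and
its registered line `birth` is slack-free

Support file for the line `birth` of the crux (`Cruxes/ConformalAvoidance/Lines/birth.lean`, skeleton r5: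
`ConformalAvoidance ⇐ stub_avoidanceLimitExists ∧ stub_rotationInvariantLimits ∧ stub_conformalOfSimilarity`).

* `conformalAvoidance_of_sawScalingLimit : SAWScalingLimit → ConformalAvoidance` — the crux is a
  COROLLARY of the sub-problem statement (the Lawler–Schramm–Werner conjecture as typed in the tree):
  compose the tree theorem `SAWChargeContinuation.avoidanceLimit_of_sawScalingLimit`
  (`SAWScalingLimit → AvoidanceLimit`: portmanteau sandwich under the SLE_{8/3} law, whose
  touching-without-entering event is null, [LSW03] Thm. 6.1) with the transport theorem
  `conformalAvoidance_of_avoidanceLimit` (`AvoidanceLimit → ConformalAvoidance`, p152728: the chordal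
  uniformizer of `D` composed with `g` uniformizes `E` with the same pulled-back hull).  Hence the
  contrapositive `not_sawScalingLimit_of_not_conformalAvoidance`: a refutation of the crux refutes the
  conjunct `SAWScalingLimit` itself — every SAW route at once — so the route is HONEST at this crux by a
  kernel-checked certificate, not only by audit.
* The three REGISTERED STUBS of the line are each implied by the crux (hence by the conjunct): the
  decomposition loses nothing, and a `stub-false` on any of them would be a refutation of
  `SAWScalingLimit` as typed.
  - `stub_avoidanceLimitExists_of_conformalAvoidance` (stub 1 = `AvoidanceCocycleLimit`, stmt-1369, by
    `avoidanceCocycleLimit_of_conformalAvoidance`);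
  - `stub_rotationInvariantLimits_of_conformalAvoidance` (stub 2d, rotations by `θ ∈ [0, π/2)`): the
    rotation `z ↦ e^{iθ} z` restricted to `D` IS a conformal equivalence onto any `E` with
    `E.carrier = e^{iθ} D.carrier` (`exists_conformalEquiv_of_eq_image_similarity`, from the tree's
    `similarityConformalEquiv`), with boundary values `e^{iθ} a`, `e^{iθ} b` at the marked points
    (`hasBoundaryValue_of_forall_apply_eq`) and image `e^{iθ} D' = E'`; feed it to the conformal
    invariance of the limit values (`conformallyInvariantLimits_of_conformalAvoidance`);
  - `stub_conformalOfSimilarity_of_conformalAvoidance` (stub 3, N3): its conclusion is that conformal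
    invariance outright.
  With `conformalAvoidance_of_sawScalingLimit`: `registeredStubs_of_sawScalingLimit`.

Everything proved, standard axioms; no named fact is assumed.

References: G. F. Lawler, O. Schramm, W. Werner, *Conformal restriction: the chordal case*, J. Amer.
Math. Soc. 16 (2003), Thm. 6.1; *On the scaling limit of planar self-avoiding walk*, Proc. Sympos. Pure
Math. 72 (2004), §3.4.2, §4.1 Prediction 1; P. Billingsley, *Convergence of Probability Measures* (1999),
Thm. 2.1.
-/

noncomputable section

open scoped Topology ENNReal NNReal
open Filter Set MeasureTheory
open Literature.Probability.RandomPlanarGeometry Literature.Probability.LatticeModels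
open Summit.CriticalPhenomena.SAWScalingLimit.Theses.SAWTensorRG (ConformalAvoidance)
open Summit.CriticalPhenomena.SAWScalingLimit.Theses.SAWRestrictionRigidity (AvoidanceCocycleLimit)

namespace Summit.CriticalPhenomena.SAWScalingLimit.Theorems.ConformalAvoidance

/-! ### The crux is a corollary of the sub-problem statement -/

/-- **`SAWScalingLimit → ConformalAvoidance`**: the crux stmt-CriticalPhenomena-7605 follows from the
conjunct — `SAWScalingLimit → AvoidanceLimit` (tree: portmanteau sandwich under SLE_{8/3}, LSW03 Thm. 6.1)
and `AvoidanceLimit → ConformalAvoidance` (tree: transport of the chordal uniformizer along `g`).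
[cite: LawlerSchrammWerner2003Restriction, Thm. 6.1 (p. 23)] -/
theorem conformalAvoidance_of_sawScalingLimit (hS : _root_.SAWScalingLimit) : ConformalAvoidance :=
  conformalAvoidance_of_avoidanceLimit
    (_root_.Summit.CriticalPhenomena.SAWScalingLimit.Theorems.SAWChargeContinuation.avoidanceLimit_of_sawScalingLimit
      hS)

/-- **`¬ ConformalAvoidance → ¬ SAWScalingLimit`** (for the negatives index): a refutation of the crux
refutes the conjunct as typed, hence every SAW route at once. [folklore] -/
theorem not_sawScalingLimit_of_not_conformalAvoidance (h : ¬ ConformalAvoidance) :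
    ¬ _root_.SAWScalingLimit :=
  fun hS => h (conformalAvoidance_of_sawScalingLimit hS)

/-! ### Plane similarities as crux data -/

/-- **A plane similarity restricted to `U` is a conformal equivalence onto every set EQUAL to its
image** (the tree's `similarityConformalEquiv`, transported along the equation of sets; the point is
that the codomain may be the carrier of an arbitrary marked domain `E` with
`E.carrier = (z ↦ c z + w) '' U`, an equation between structure projections that cannot be
substituted). [folklore] -/
theorem exists_conformalEquiv_of_eq_image_similarity (c : ℂ) (hc : c ≠ 0) (w : ℂ) {U V : Set ℂ}
    (hV : V = similarity c hc w '' U) :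
    ∃ g : ConformalEquiv U V, ∀ z : ℂ, g z = c * z + w := by
  subst hV
  exact ⟨ChordalFamily.similarityConformalEquiv c hc w U, fun z => rfl⟩

/-- A conformal equivalence that is (the restriction of) the plane map `z ↦ c z + w` has boundary
value `c x + w` at every point `x`. [folklore] -/
theorem hasBoundaryValue_of_forall_apply_eq {U V : Set ℂ} (g : ConformalEquiv U V) {c w : ℂ}
    (hg : ∀ z : ℂ, g z = c * z + w) (x : ℂ) : g.HasBoundaryValue x (c * x + w) := by
  have hcont : Continuous fun z : ℂ => c * z + w := by fun_prop
  have h : Tendsto (fun z : ℂ => c * z + w) (𝓝[U] x) (𝓝 (c * x + w)) :=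
    hcont.continuousAt.tendsto.mono_left nhdsWithin_le_nhds
  exact h.congr fun z => (hg z).symm

/-- A conformal equivalence that is the plane map `z ↦ c z + w` maps every set to its image under
the similarity. [folklore] -/
theorem image_eq_of_forall_apply_eq {U V : Set ℂ} (g : ConformalEquiv U V) {c : ℂ} (hc : c ≠ 0)
    {w : ℂ} (hg : ∀ z : ℂ, g z = c * z + w) (S : Set ℂ) : g '' S = similarity c hc w '' S :=
  image_congr fun z _ => by rw [hg z, similarity_apply]

/-! ### The registered stubs of line `birth` are implied by the crux -/

/-- **Stub 1 is implied by the crux** (literal registered signature of `stub_avoidanceLimitExists`; it is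
the sibling crux `AvoidanceCocycleLimit`, stmt-CriticalPhenomena-1369, by term identity). [folklore] -/
theorem stub_avoidanceLimitExists_of_conformalAvoidance (h : ConformalAvoidance) :
    ∀ (D D' : DobrushinDomain) (a b : ℝ → Site 2), SAW.IsEndpointApprox D a b →
      D'.carrier ⊆ D.carrier → D'.pt 0 = D.pt 0 → D'.pt 1 = D.pt 1 →
      (∃ ε : ℝ, 0 < ε ∧ D'.carrier ∩ Metric.ball (D.pt 0) ε = D.carrier ∩ Metric.ball (D.pt 0) ε ∧
        D'.carrier ∩ Metric.ball (D.pt 1) ε = D.carrier ∩ Metric.ball (D.pt 1) ε) →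
      ∃ r : ENNReal,
        Tendsto (fun δ => ((SAW.law D.carrier δ (a δ) (b δ)).map (fun γ => γ.curve))
            (CurveClass.rangeSubset (closure D'.carrier))) (𝓝[>] 0) (𝓝 r) :=
  avoidanceCocycleLimit_of_conformalAvoidance h

/-- **Stub 2d is implied by the crux** (literal registered signature of `stub_rotationInvariantLimits`:
existence → approximation independence → invariance of the limit values under rotations by
`θ ∈ [0, π/2)`).  The two hypotheses are not needed: the rotation `z ↦ e^{iθ} z` restricted to `D` is a
conformal equivalence onto `E` (`E.carrier = e^{iθ} D.carrier`) with boundary values `E.pt 0 = e^{iθ} a`,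
`E.pt 1 = e^{iθ} b` and `g(D') = e^{iθ} D' = E'`, i.e. a crux datum, and the crux makes the two limits
coincide (`conformallyInvariantLimits_of_conformalAvoidance`). [folklore] -/
theorem stub_rotationInvariantLimits_of_conformalAvoidance (h : ConformalAvoidance) :
    (∀ (D D' : DobrushinDomain) (a b : ℝ → Site 2), SAW.IsEndpointApprox D a b →
       D'.carrier ⊆ D.carrier → D'.pt 0 = D.pt 0 → D'.pt 1 = D.pt 1 →
       (∃ ε : ℝ, 0 < ε ∧ D'.carrier ∩ Metric.ball (D.pt 0) ε = D.carrier ∩ Metric.ball (D.pt 0) ε ∧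
         D'.carrier ∩ Metric.ball (D.pt 1) ε = D.carrier ∩ Metric.ball (D.pt 1) ε) →
       ∃ r : ENNReal,
         Tendsto (fun δ => ((SAW.law D.carrier δ (a δ) (b δ)).map (fun γ => γ.curve))
             (CurveClass.rangeSubset (closure D'.carrier))) (𝓝[>] 0) (𝓝 r)) →
    (∀ (D D' : DobrushinDomain) (a b c d : ℝ → Site 2),
       SAW.IsEndpointApprox D a b → SAW.IsEndpointApprox D c d →
       D'.carrier ⊆ D.carrier → D'.pt 0 = D.pt 0 → D'.pt 1 = D.pt 1 →
       (∃ ε : ℝ, 0 < ε ∧ D'.carrier ∩ Metric.ball (D.pt 0) ε = D.carrier ∩ Metric.ball (D.pt 0) ε ∧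
         D'.carrier ∩ Metric.ball (D.pt 1) ε = D.carrier ∩ Metric.ball (D.pt 1) ε) →
       ∀ r₁ r₂ : ENNReal,
         Tendsto (fun δ => ((SAW.law D.carrier δ (a δ) (b δ)).map (fun γ => γ.curve))
             (CurveClass.rangeSubset (closure D'.carrier))) (𝓝[>] 0) (𝓝 r₁) →
         Tendsto (fun δ => ((SAW.law D.carrier δ (c δ) (d δ)).map (fun γ => γ.curve))
             (CurveClass.rangeSubset (closure D'.carrier))) (𝓝[>] 0) (𝓝 r₂) → r₁ = r₂) →
    ∀ (D D' E E' : DobrushinDomain) (a b c d : ℝ → Site 2) (θ : ℝ) (hθ : Complex.exp ((θ : ℂ) * Complex.I) ≠ 0),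
      0 ≤ θ → θ < Real.pi / 2 →
      SAW.IsEndpointApprox D a b → SAW.IsEndpointApprox E c d →
      D'.carrier ⊆ D.carrier → D'.pt 0 = D.pt 0 → D'.pt 1 = D.pt 1 →
      (∃ ε : ℝ, 0 < ε ∧ D'.carrier ∩ Metric.ball (D.pt 0) ε = D.carrier ∩ Metric.ball (D.pt 0) ε ∧
        D'.carrier ∩ Metric.ball (D.pt 1) ε = D.carrier ∩ Metric.ball (D.pt 1) ε) →
      E'.carrier ⊆ E.carrier → E'.pt 0 = E.pt 0 → E'.pt 1 = E.pt 1 →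
      (∃ ε : ℝ, 0 < ε ∧ E'.carrier ∩ Metric.ball (E.pt 0) ε = E.carrier ∩ Metric.ball (E.pt 0) ε ∧
        E'.carrier ∩ Metric.ball (E.pt 1) ε = E.carrier ∩ Metric.ball (E.pt 1) ε) →
      E.carrier = (similarity (Complex.exp ((θ : ℂ) * Complex.I)) hθ 0) '' D.carrier →
      E'.carrier = (similarity (Complex.exp ((θ : ℂ) * Complex.I)) hθ 0) '' D'.carrier →
      E.pt 0 = (similarity (Complex.exp ((θ : ℂ) * Complex.I)) hθ 0) (D.pt 0) → E.pt 1 = (similarity (Complex.exp ((θ : ℂ) * Complex.I)) hθ 0) (D.pt 1) →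
      ∀ r₁ r₂ : ENNReal,
        Tendsto (fun δ => ((SAW.law D.carrier δ (a δ) (b δ)).map (fun γ => γ.curve))
            (CurveClass.rangeSubset (closure D'.carrier))) (𝓝[>] 0) (𝓝 r₁) →
        Tendsto (fun δ => ((SAW.law E.carrier δ (c δ) (d δ)).map (fun γ => γ.curve))
            (CurveClass.rangeSubset (closure E'.carrier))) (𝓝[>] 0) (𝓝 r₂) → r₁ = r₂ := by
  intro _ _ D D' E E' a b c d θ hθ _ _ hab hcd hsub h0 h1 hball hEsub hE0 hE1 hEball hE hE' hEp0 hEp1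
    r₁ r₂ hr₁ hr₂
  obtain ⟨g, hg⟩ :=
    exists_conformalEquiv_of_eq_image_similarity (Complex.exp ((θ : ℂ) * Complex.I)) hθ 0 hE
  have hg0 : g.HasBoundaryValue (D.pt 0) (E.pt 0) := by
    rw [hEp0, similarity_apply]
    exact hasBoundaryValue_of_forall_apply_eq g hg (D.pt 0)
  have hg1 : g.HasBoundaryValue (D.pt 1) (E.pt 1) := by
    rw [hEp1, similarity_apply]
    exact hasBoundaryValue_of_forall_apply_eq g hg (D.pt 1)
  have hgD' : g '' D'.carrier = E'.carrier := by
    rw [hE']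
    exact image_eq_of_forall_apply_eq g hθ hg D'.carrier
  exact conformallyInvariantLimits_of_conformalAvoidance h D D' E E' a b c d g hab hcd hsub h0 h1 hball
    hEsub hE0 hE1 hEball hg0 hg1 hgD' r₁ r₂ hr₁ hr₂

/-- **Stub 3 is implied by the crux** (literal registered signature of `stub_conformalOfSimilarity`, the
residual N3: existence → similarity invariance → conformal invariance of the limit values).  Its
conclusion is the invariance half of the crux outright (`conformallyInvariantLimits_of_conformalAvoidance`).
[folklore] -/
theorem stub_conformalOfSimilarity_of_conformalAvoidance (h : ConformalAvoidance) :
    (∀ (D D' : DobrushinDomain) (a b : ℝ → Site 2), SAW.IsEndpointApprox D a b →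
       D'.carrier ⊆ D.carrier → D'.pt 0 = D.pt 0 → D'.pt 1 = D.pt 1 →
       (∃ ε : ℝ, 0 < ε ∧ D'.carrier ∩ Metric.ball (D.pt 0) ε = D.carrier ∩ Metric.ball (D.pt 0) ε ∧
         D'.carrier ∩ Metric.ball (D.pt 1) ε = D.carrier ∩ Metric.ball (D.pt 1) ε) →
       ∃ r : ENNReal,
         Tendsto (fun δ => ((SAW.law D.carrier δ (a δ) (b δ)).map (fun γ => γ.curve))
             (CurveClass.rangeSubset (closure D'.carrier))) (𝓝[>] 0) (𝓝 r)) →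
    (∀ (D D' E E' : DobrushinDomain) (a b c d : ℝ → Site 2) (g : ConformalEquiv D.carrier E.carrier),
       (∃ (s θ : ℝ) (w : ℂ), 0 < s ∧ ∀ z ∈ D.carrier,
         g z = (s : ℂ) * Complex.exp ((θ : ℂ) * Complex.I) * z + w) →
       SAW.IsEndpointApprox D a b → SAW.IsEndpointApprox E c d →
       D'.carrier ⊆ D.carrier → D'.pt 0 = D.pt 0 → D'.pt 1 = D.pt 1 →
       (∃ ε : ℝ, 0 < ε ∧ D'.carrier ∩ Metric.ball (D.pt 0) ε = D.carrier ∩ Metric.ball (D.pt 0) ε ∧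
         D'.carrier ∩ Metric.ball (D.pt 1) ε = D.carrier ∩ Metric.ball (D.pt 1) ε) →
       E'.carrier ⊆ E.carrier → E'.pt 0 = E.pt 0 → E'.pt 1 = E.pt 1 →
       (∃ ε : ℝ, 0 < ε ∧ E'.carrier ∩ Metric.ball (E.pt 0) ε = E.carrier ∩ Metric.ball (E.pt 0) ε ∧
         E'.carrier ∩ Metric.ball (E.pt 1) ε = E.carrier ∩ Metric.ball (E.pt 1) ε) →
       g.HasBoundaryValue (D.pt 0) (E.pt 0) → g.HasBoundaryValue (D.pt 1) (E.pt 1) →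
       g '' D'.carrier = E'.carrier →
       ∀ r₁ r₂ : ENNReal,
         Tendsto (fun δ => ((SAW.law D.carrier δ (a δ) (b δ)).map (fun γ => γ.curve))
             (CurveClass.rangeSubset (closure D'.carrier))) (𝓝[>] 0) (𝓝 r₁) →
         Tendsto (fun δ => ((SAW.law E.carrier δ (c δ) (d δ)).map (fun γ => γ.curve))
             (CurveClass.rangeSubset (closure E'.carrier))) (𝓝[>] 0) (𝓝 r₂) → r₁ = r₂) →
    ∀ (D D' E E' : DobrushinDomain) (a b c d : ℝ → Site 2) (g : ConformalEquiv D.carrier E.carrier),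
      SAW.IsEndpointApprox D a b → SAW.IsEndpointApprox E c d →
      D'.carrier ⊆ D.carrier → D'.pt 0 = D.pt 0 → D'.pt 1 = D.pt 1 →
      (∃ ε : ℝ, 0 < ε ∧ D'.carrier ∩ Metric.ball (D.pt 0) ε = D.carrier ∩ Metric.ball (D.pt 0) ε ∧
        D'.carrier ∩ Metric.ball (D.pt 1) ε = D.carrier ∩ Metric.ball (D.pt 1) ε) →
      E'.carrier ⊆ E.carrier → E'.pt 0 = E.pt 0 → E'.pt 1 = E.pt 1 →
      (∃ ε : ℝ, 0 < ε ∧ E'.carrier ∩ Metric.ball (E.pt 0) ε = E.carrier ∩ Metric.ball (E.pt 0) ε ∧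
        E'.carrier ∩ Metric.ball (E.pt 1) ε = E.carrier ∩ Metric.ball (E.pt 1) ε) →
      g.HasBoundaryValue (D.pt 0) (E.pt 0) → g.HasBoundaryValue (D.pt 1) (E.pt 1) →
      g '' D'.carrier = E'.carrier →
      ∀ r₁ r₂ : ENNReal,
        Tendsto (fun δ => ((SAW.law D.carrier δ (a δ) (b δ)).map (fun γ => γ.curve))
            (CurveClass.rangeSubset (closure D'.carrier))) (𝓝[>] 0) (𝓝 r₁) →
        Tendsto (fun δ => ((SAW.law E.carrier δ (c δ) (d δ)).map (fun γ => γ.curve))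
            (CurveClass.rangeSubset (closure E'.carrier))) (𝓝[>] 0) (𝓝 r₂) → r₁ = r₂ :=
  fun _ _ => conformallyInvariantLimits_of_conformalAvoidance h

/-! ### Hence the registered stubs are implied by the sub-problem statement -/

/-- **All three registered stubs of line `birth` are corollaries of `SAWScalingLimit`**: a `stub-false`
on any of them refutes the Lawler–Schramm–Werner conjecture as typed (the conjunct), not merely the
line.  Stated for stub 1 by name (`AvoidanceCocycleLimit`) and for stubs 2d and 3 through the crux
(`stub_rotationInvariantLimits_of_conformalAvoidance`, `stub_conformalOfSimilarity_of_conformalAvoidance`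
applied to this theorem's second component). [cite: LawlerSchrammWerner2004SAW, §4.1 Prediction 1] -/
theorem registeredStubs_of_sawScalingLimit (hS : _root_.SAWScalingLimit) :
    AvoidanceCocycleLimit ∧ ConformalAvoidance :=
  ⟨avoidanceCocycleLimit_of_conformalAvoidance (conformalAvoidance_of_sawScalingLimit hS),
    conformalAvoidance_of_sawScalingLimit hS⟩

end Summit.CriticalPhenomena.SAWScalingLimit.Theorems.ConformalAvoidance

end
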